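import Summits.QuantumFields.YangMills.Theorems.UnitScaleTiltProp8HalvingELJunction
import HarnessLib

/-!
# K0⁷ STUB 1 (`stub_prop8StepCoP13`), sub-target S4 — **THE NORMALISATION OF THE SECT. D MULTIPLIER AT NODE 00's CARRIER**: for the pairings of record
# (`BE = bondPair η d τ = η^d·Σ_b τ(··)` on fine fields, [15] (27); the UNWEIGHTED trace pairing `B = Σ_t τ(··)` on block data, p598821) the operator `M` for which
# `½B(D, MD) − B(QA′, MD)` IS the Hessian piece of the linearised action (26)∕(88) is `η^d•((QGQ*)⁻¹ − a)`; the composite `Qᵗ∘(η^d•M)` IS the curl–curl row of `H`;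
# and `(QGQ*)⁻¹ − a` is canonical (free of the auxiliary weights `a`)

Cell `pub-ymgap`, width seat `pub-ymgap-k0-s1-w4` g0 (CLAIM-3 ∕ LOCATED-M-NORMALISATION on the cell bus).  `--kind proof --supports stmt-QuantumFields-20541 --as helper`;
count-neutral.  [15] = [Balaban1985Variational] (CMP **102** (1985) 277–309); [B6] = [Balaban1984PropagatorsII] (CMP **96** (1984) 223–250).

WHY.  S4b's capstone (`K0Stub1SectFWSlotOneLevel.exists_sectF_W_oneLevel ∕ _levOf`, p596653) differentiates `V(A′) = ½B(D A′, M(D A′)) − B(Q A′, M(D A′)) + V₀(A′ − H D A′)`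
with respect to the fine pairing `BE` ((27), η^d-weighted — lit-balaban's `B9Eq39Adjoint.bondPair`) and the block pairing `B` UNWEIGHTED (`K0Stub1PairingsAtExtensions`,
p598821), keeping `M` abstract (`hM : B (M a) b = B a (M b)`); p598821 offers `M_V` := the componentwise extension of lit-balaban's `EE D − aE D w` (print's
`(QGQ*)⁻¹ − a`).  The linearised action (26) (`B11Eq26ActionExpansion.V0 ∕ hessPair`) carries print's `η^d`; expanding `½⟨A′ − HX, ∂*∂(A′ − HX)⟩_η` with lit-balaban's
PLAIN-adjoint identity `∂*∂∘H = Q*∘((QGQ*)⁻¹ − a)` (UST `HalvingELJunction.QsE_EE_eq` = `Δ_aH = Q*(QGQ*)⁻¹`, `R∂*H = 0`, `QH = 1`) gives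
`−BE(A′, ∂*∂H_VX) + ½BE(H_VX, ∂*∂H_VX) = −B(Q_VA′, (η^d•M_V)X) + ½B(X, (η^d•M_V)X)`: the multiplier matching the capstone's functional is `η^d•M_V`
([15] (87)–(88): *«⟨A′, (Δ + DRD*)HD(A′)⟩ … hence the functional derivative is equal to Q*(QGQ*)⁻¹(L^{(·)}η)⁻¹D(A′) − Q*a(L^{(·)}η)⁻¹D(A′)»*, derivatives taken in the
η-weighted pairing (63)).  THIS FILE kernel-checks exactly these identities at p598821's kernel shapes, for every nested family, every fibre algebra and every trace-like
ℂ-linear `τ` — so that the S6 assembly instantiates the capstone with `MV := η^d • M_V` — and records that the composite `Qᵗ_V∘(η^d•M_V)` is the kernel extension of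
`∂*∂∘H` (whose letter is the text's `∂*∂`-row of `H`: k0-s1-w3's `HDecayLetterD` row 3, cf. `K0Stub1MultiplierLetterP.rowsSup_real`), and that `(QGQ*)⁻¹ − a` does
not depend on `a`.

WHAT IS PROVED (sorry-free; no definition; axioms standard).  Every `D : Domains P`, `c ≠ 0`, weights `w, w′ > 0`; §2–§3 for every ℂ-algebra `𝔸` and ℂ-linear `τ`.
* §1 (real kernels, V1 model) `QsE_sub_aE_eq_curlCurl_hOp` (`Q*((E − a)β) = ∂*∂(Hβ)`), ★ `EE_sub_aE_eq_of_weights` (`E_a − a = E_{a′} − a′`), `curlCurlH_kernel_eq_sum`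
  (`(∂*∂He_s)(b) = Σ_t (Qe_b)(t)·((E−a)e_s)(t)`), `mult_kernel_eq_sum` (`((E−a)e_s)(t) = Σ_b (He_t)(b)·(∂*∂He_s)(b)`).
* §2 (kernel extensions, p598821's shapes) ★ `QtV_smul_MV_eq_curlCurlHV` (`Qᵗ_V((η^d•M_V)X) = (∂*∂H)_V X`, `Qᵗ_V = (η^d)⁻¹•Qᵀ` as in `exists_pairings_transposes_flatOps`).
* §3 (pairings) ★★ `BE_curlCurlHV_eq_B_smul_MV` (`BE(A′, (∂*∂H)_VX) = B(Q_VA′, (η^d•M_V)X)`) · ★★ `BE_HV_curlCurlHV_eq_B_smul_MV` (`BE(H_VX, (∂*∂H)_VX′) = B(X, (η^d•M_V)X′)`).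
HONEST SCOPE.  Finite-dimensional algebra over kernel-checked lit-balaban ∕ UST identities; a NORMALISATION reading for the S4b junction, not an estimate; which `M` the S6
assembly adopts is the S4 lanes' decision; nothing of Bałaban's analysis asserted; `stub_prop8StepCoP13` ∕ K0⁷ NOT closed; N07 NOT discharged; counts unmoved (28∕28 · 5∕27);
one finite 𝕋⁴ programme at fixed ε — R4 closes the conditional finite-𝕋⁴ rung `BalabanLadder.UV` only, never the summit; the YM mass gap (Clay) is NOT proved by any of
this; nothing continuum ∕ ℝ⁴ ∕ OS.  No `sorry`, no `def`, no `instance`, no `notation`.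

References: [15] (26)–(27) p.282, (63) p.287, (66) p.287, (87)–(88) p.291, (157)–(158) p.302; [B6] (2.19)–(2.22) p.226, (2.34)–(2.35) p.228.
-/

set_option autoImplicit false

noncomputable section

open scoped BigOperators InnerProductSpace

namespace Summit.QuantumFields.YangMills.Theorems.K0Stub1MultiplierNormalisation

open Literature.MathematicalPhysics.QuantumFieldTheory.Balaban1983to89
open Literature.MathematicalPhysics.QuantumFieldTheory.BalabanImbrieJaffe1984to88.BIJ85AxialPropagator411 (BondSpace)
open B6SectADomainsV1 (Domains)
open B6SectAOperatorsV1 (BondIdx BondIdxSpace QE QsE dcE dcsE aE inner_eq_sum inner_QsE_left)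
open B6SectAVectorModelV1 (GE EE QsE_injective)
open B6SectA (hOp)
open Summit.QuantumFields.YangMills.Theorems.FlatCubeOperators (QE_hOp hOp_eq_hOp)
open Summit.QuantumFields.YangMills.Theorems.HalvingELJunction (QsE_EE_eq)

/-! ## §1  Real kernels: `Q*(E − a) = ∂*∂H`, canonicity of `E − a`, and the two kernel sums -/

section Model

variable {P : Params} (D : Domains P) {c : ℝ} (hc : c ≠ 0) {w w' : BondIdx D → ℝ} (hw : ∀ i, 0 < w i) (hw' : ∀ i, 0 < w' i)

/-- **`Q*((QGQ*)⁻¹ − a)β = ∂*∂(Hβ)`** — UST `QsE_EE_eq` with the diagonal term moved (`Δ_aH = Q*(QGQ*)⁻¹`, `R∂*H = 0`, `QH = 1`).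
[cite: Balaban1985Variational, (87)-(88) p.291; Balaban1984PropagatorsII, (2.34)-(2.35) p.228] -/
theorem QsE_sub_aE_eq_curlCurl_hOp (β : BondIdxSpace D) :
    QsE D ((EE D hc hw - aE D w) β) = dcsE c (dcE c (hOp (GE D hc hw) (QsE D) (EE D hc hw) β)) := by
  rw [LinearMap.sub_apply, map_sub, QsE_EE_eq D hc hw β, add_sub_cancel_right]

/-- ★ **`(QGQ*)⁻¹ − a` DOES NOT DEPEND ON THE AUXILIARY WEIGHTS `a`** ([B6] p. 228 «the only assumption we have used was the positivity of Δ_a»): `Q*` is injective and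
`Q*(E_a − a) = ∂*∂H` with `H` canonical (`FlatCubeOperators.hOp_eq_hOp`). [cite: Balaban1984PropagatorsII, (2.35) p.228; Balaban1985Variational, (88) p.291] -/
theorem EE_sub_aE_eq_of_weights : EE D hc hw - aE D w = EE D hc hw' - aE D w' := by
  refine LinearMap.ext fun β => QsE_injective D ?_
  rw [QsE_sub_aE_eq_curlCurl_hOp D hc hw, QsE_sub_aE_eq_curlCurl_hOp D hc hw', hOp_eq_hOp D hc hw hw']

/-- the kernel of `∂*∂∘H` through the kernels of `Q` and `E − a`: `(∂*∂He_s)(b) = Σ_t (Qe_b)(t)·((E − a)e_s)(t)` (evaluate `Q*((E−a)e_s)` at `b`).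
[cite: Balaban1985Variational, (88) p.291 (bookkeeping)] -/
theorem curlCurlH_kernel_eq_sum [DecidableEq (PBond P 0)] [DecidableEq (BondIdx D)] (s : BondIdx D) (b : PBond P 0) :
    WithLp.ofLp (dcsE c (dcE c (hOp (GE D hc hw) (QsE D) (EE D hc hw) (WithLp.toLp 2 (Pi.single s 1))))) b =
      ∑ t, WithLp.ofLp (QE D (WithLp.toLp 2 (Pi.single b 1))) t * WithLp.ofLp ((EE D hc hw - aE D w) (WithLp.toLp 2 (Pi.single s 1))) t := by
  set v : BondIdxSpace D := (EE D hc hw - aE D w) (WithLp.toLp 2 (Pi.single s 1)) with hv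
  have h1 : dcsE c (dcE c (hOp (GE D hc hw) (QsE D) (EE D hc hw) (WithLp.toLp 2 (Pi.single s 1)))) = QsE D v := by
    rw [hv, QsE_sub_aE_eq_curlCurl_hOp D hc hw]
  have h2 : WithLp.ofLp (QsE D v) b = ⟪QsE D v, EuclideanSpace.single b (1 : ℝ)⟫_ℝ := by
    rw [EuclideanSpace.inner_single_right]; simp
  rw [h1, h2, inner_QsE_left, inner_eq_sum]
  refine Finset.sum_congr rfl fun t _ => ?_
  rw [mul_comm]
  rfl

/-- the kernel of `E − a` through the kernels of `H` and `∂*∂∘H`: `((E − a)e_s)(t) = Σ_b (He_t)(b)·(∂*∂He_s)(b)` (`QH = 1` and `⟨Q(He_t), v⟩ = ⟨He_t, Q*v⟩`).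
[cite: Balaban1985Variational, (45) p.285, (88) p.291 (bookkeeping)] -/
theorem mult_kernel_eq_sum [DecidableEq (PBond P 0)] [DecidableEq (BondIdx D)] (s t : BondIdx D) :
    WithLp.ofLp ((EE D hc hw - aE D w) (WithLp.toLp 2 (Pi.single s 1))) t =
      ∑ b, WithLp.ofLp (hOp (GE D hc hw) (QsE D) (EE D hc hw) (WithLp.toLp 2 (Pi.single t 1))) b *
        WithLp.ofLp (dcsE c (dcE c (hOp (GE D hc hw) (QsE D) (EE D hc hw) (WithLp.toLp 2 (Pi.single s 1))))) b := by
  set v : BondIdxSpace D := (EE D hc hw - aE D w) (WithLp.toLp 2 (Pi.single s 1)) with hv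
  set Ht : BondSpace P := hOp (GE D hc hw) (QsE D) (EE D hc hw) (WithLp.toLp 2 (Pi.single t 1)) with hHt
  have h1 : dcsE c (dcE c (hOp (GE D hc hw) (QsE D) (EE D hc hw) (WithLp.toLp 2 (Pi.single s 1)))) = QsE D v := by
    rw [hv, QsE_sub_aE_eq_curlCurl_hOp D hc hw]
  have h2 : WithLp.ofLp v t = ⟪EuclideanSpace.single t (1 : ℝ), v⟫_ℝ := by
    rw [EuclideanSpace.inner_single_left]; simp
  have h3 : (EuclideanSpace.single t (1 : ℝ) : BondIdxSpace D) = QE D Ht := by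
    rw [hHt, QE_hOp]; rfl
  rw [h2, h3, ← real_inner_comm, ← inner_QsE_left, real_inner_comm, ← h1, inner_eq_sum]

end Model

/-! ## §2  The composite `Qᵗ_V ∘ (η^d•M_V)` is the kernel extension of `∂*∂∘H` -/

section Extensions

variable {P : Params} (D : Domains P) {c : ℝ} (hc : c ≠ 0) {w : BondIdx D → ℝ} (hw : ∀ i, 0 < w i)
variable {𝔸 : Type*} [Ring 𝔸] [Algebra ℂ 𝔸]

/-- ★ **`Qᵗ_V((η^d•M_V)X) = (∂*∂H)_V X`** for the extensions of p598821's `exists_pairings_transposes_flatOps` (`Qᵗ_V = (η^d)⁻¹•` transposed `Q`-kernel, `M_V` = extension of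
`EE − aE`) and the kernel extension `K_V` of `∂*∂∘H` — so the capstone's term `Qᵗ(M(D A′))`, at the correctly normalised multiplier, is `(∂*∂H)_V(D A′)` and its letter is the
text's `∂*∂`-row of `H`, with no multiplier ∕ transpose letter. [cite: Balaban1985Variational, (87)-(88) p.291, (27) p.282, (66) p.287] -/
theorem QtV_smul_MV_eq_curlCurlHV [DecidableEq (PBond P 0)] [DecidableEq (BondIdx D)] {η : ℝ} (hη : η ≠ 0)
    {MV : (BondIdx D → 𝔸) →ₗ[ℂ] (BondIdx D → 𝔸)} {QtV KV : (BondIdx D → 𝔸) →ₗ[ℂ] (PBond P 0 → 𝔸)}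
    (hMV : ∀ (X : BondIdx D → 𝔸) (t : BondIdx D),
      MV X t = ∑ s, ((WithLp.ofLp ((EE D hc hw - aE D w) (WithLp.toLp 2 (Pi.single s 1))) t : ℝ) : ℂ) • X s)
    (hQtV : ∀ (X : BondIdx D → 𝔸) (j : PBond P 0),
      QtV X j = ((η : ℂ) ^ P.d)⁻¹ • ∑ t, ((WithLp.ofLp (QE D (WithLp.toLp 2 (Pi.single j 1))) t : ℝ) : ℂ) • X t)
    (hKV : ∀ (X : BondIdx D → 𝔸) (b : PBond P 0),
      KV X b = ∑ s, ((WithLp.ofLp (dcsE c (dcE c (hOp (GE D hc hw) (QsE D) (EE D hc hw) (WithLp.toLp 2 (Pi.single s 1))))) b : ℝ) : ℂ) • X s)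
    (X : BondIdx D → 𝔸) (b : PBond P 0) :
    QtV (((η : ℂ) ^ P.d) • MV X) b = KV X b := by
  have hηd : ((η : ℂ) ^ P.d) ≠ 0 := pow_ne_zero _ (Complex.ofReal_ne_zero.mpr hη)
  rw [hQtV, hKV]
  simp_rw [Pi.smul_apply, hMV, Finset.smul_sum, smul_smul]
  rw [Finset.sum_comm]
  refine Finset.sum_congr rfl fun s _ => ?_
  rw [← Finset.sum_smul, curlCurlH_kernel_eq_sum D hc hw s b]
  congr 1
  push_cast
  refine Finset.sum_congr rfl fun t _ => ?_
  field_simp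

end Extensions

/-! ## §3  The pairing identities: `η^d•M_V` is the multiplier of the capstone's functional -/

section Pairings

variable {P : Params} (D : Domains P) {c : ℝ} (hc : c ≠ 0) {w : BondIdx D → ℝ} (hw : ∀ i, 0 < w i)
variable {𝔸 : Type*} [Ring 𝔸] [Algebra ℂ 𝔸] (τ : 𝔸 →ₗ[ℂ] ℂ)

/-- ★★ **THE CROSS TERM**: `BE(A′, (∂*∂H)_V X) = B(Q_V A′, (η^d•M_V) X)` — with `BE Y δ = η^d Σ_b τ(Y_b δ_b)` ((27) on `PBond`, p598821 `bondPair_PBond_eq_sum`) and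
`B X X′ = Σ_t τ(X_t X′_t)` (unweighted): the `−⟨A′, ΔHD(A′)⟩` term of [15] (87) in the capstone's form `−B(QA′, M(DA′))` forces `M = η^d•((QGQ*)⁻¹ − a)_V`.
[cite: Balaban1985Variational, (87)-(88) p.291, (27) p.282, (66) p.287] -/
theorem BE_curlCurlHV_eq_B_smul_MV [DecidableEq (PBond P 0)] [DecidableEq (BondIdx D)] (η : ℝ)
    {BE : (PBond P 0 → 𝔸) →ₗ[ℂ] (PBond P 0 → 𝔸) →ₗ[ℂ] ℂ} {B : (BondIdx D → 𝔸) →ₗ[ℂ] (BondIdx D → 𝔸) →ₗ[ℂ] ℂ}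
    (hBE : ∀ Y δ : PBond P 0 → 𝔸, BE Y δ = ((η : ℂ) ^ P.d) * ∑ b, τ (Y b * δ b))
    (hB : ∀ X X' : BondIdx D → 𝔸, B X X' = ∑ t, τ (X t * X' t))
    {QV : (PBond P 0 → 𝔸) →ₗ[ℂ] (BondIdx D → 𝔸)} {MV : (BondIdx D → 𝔸) →ₗ[ℂ] (BondIdx D → 𝔸)} {KV : (BondIdx D → 𝔸) →ₗ[ℂ] (PBond P 0 → 𝔸)}
    (hQV : ∀ (A : PBond P 0 → 𝔸) (t : BondIdx D), QV A t = ∑ j, ((WithLp.ofLp (QE D (WithLp.toLp 2 (Pi.single j 1))) t : ℝ) : ℂ) • A j)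
    (hMV : ∀ (X : BondIdx D → 𝔸) (t : BondIdx D),
      MV X t = ∑ s, ((WithLp.ofLp ((EE D hc hw - aE D w) (WithLp.toLp 2 (Pi.single s 1))) t : ℝ) : ℂ) • X s)
    (hKV : ∀ (X : BondIdx D → 𝔸) (b : PBond P 0),
      KV X b = ∑ s, ((WithLp.ofLp (dcsE c (dcE c (hOp (GE D hc hw) (QsE D) (EE D hc hw) (WithLp.toLp 2 (Pi.single s 1))))) b : ℝ) : ℂ) • X s)
    (A' : PBond P 0 → 𝔸) (X : BondIdx D → 𝔸) :
    BE A' (KV X) = B (QV A') (((η : ℂ) ^ P.d) • MV X) := by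
  rw [hBE, hB]
  -- both sides as `η^d Σ_b Σ_s (coefficient)·τ(A′_b X_s)`
  have lhs : ∑ b, τ (A' b * KV X b) =
      ∑ b, ∑ s, ((WithLp.ofLp (dcsE c (dcE c (hOp (GE D hc hw) (QsE D) (EE D hc hw) (WithLp.toLp 2 (Pi.single s 1))))) b : ℝ) : ℂ) * τ (A' b * X s) := by
    refine Finset.sum_congr rfl fun b _ => ?_
    rw [hKV, Finset.mul_sum, map_sum]
    refine Finset.sum_congr rfl fun s _ => ?_
    rw [mul_smul_comm, map_smul, smul_eq_mul]
  have rhs : ∑ t, τ (QV A' t * (((η : ℂ) ^ P.d) • MV X) t) =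
      ((η : ℂ) ^ P.d) * ∑ b, ∑ s, (∑ t, ((WithLp.ofLp (QE D (WithLp.toLp 2 (Pi.single b 1))) t : ℝ) : ℂ) *
        ((WithLp.ofLp ((EE D hc hw - aE D w) (WithLp.toLp 2 (Pi.single s 1))) t : ℝ) : ℂ)) * τ (A' b * X s) := by
    have step : ∀ t, τ (QV A' t * (((η : ℂ) ^ P.d) • MV X) t) =
        ((η : ℂ) ^ P.d) * ∑ b, ∑ s, (((WithLp.ofLp (QE D (WithLp.toLp 2 (Pi.single b 1))) t : ℝ) : ℂ) *
          ((WithLp.ofLp ((EE D hc hw - aE D w) (WithLp.toLp 2 (Pi.single s 1))) t : ℝ) : ℂ)) * τ (A' b * X s) := by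
      intro t
      rw [Pi.smul_apply, hQV, hMV, Finset.smul_sum, Finset.sum_mul, map_sum, Finset.mul_sum]
      refine Finset.sum_congr rfl fun b _ => ?_
      rw [Finset.mul_sum, map_sum, Finset.mul_sum]
      refine Finset.sum_congr rfl fun s _ => ?_
      rw [smul_smul, smul_mul_smul_comm, map_smul, smul_eq_mul]
      ring
    simp_rw [step]
    rw [← Finset.mul_sum]
    congr 1
    rw [Finset.sum_comm]
    refine Finset.sum_congr rfl fun b _ => ?_
    rw [Finset.sum_comm]
    refine Finset.sum_congr rfl fun s _ => ?_
    rw [Finset.sum_mul]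
  rw [lhs, rhs]
  congr 1
  refine Finset.sum_congr rfl fun b _ => Finset.sum_congr rfl fun s _ => ?_
  rw [curlCurlH_kernel_eq_sum D hc hw s b]
  push_cast
  rfl

/-- ★★ **THE SQUARE TERM**: `BE(H_V X, (∂*∂H)_V X′) = B(X, (η^d•M_V) X′)` (`QH = 1`): the `½⟨HD, ΔHD⟩` term of the linearised action in the capstone's form `½B(D, M D)` again
forces `M = η^d•((QGQ*)⁻¹ − a)_V`. [cite: Balaban1985Variational, (87)-(88) p.291, (45) p.285, (27) p.282] -/
theorem BE_HV_curlCurlHV_eq_B_smul_MV [DecidableEq (PBond P 0)] [DecidableEq (BondIdx D)] (η : ℝ)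
    {BE : (PBond P 0 → 𝔸) →ₗ[ℂ] (PBond P 0 → 𝔸) →ₗ[ℂ] ℂ} {B : (BondIdx D → 𝔸) →ₗ[ℂ] (BondIdx D → 𝔸) →ₗ[ℂ] ℂ}
    (hBE : ∀ Y δ : PBond P 0 → 𝔸, BE Y δ = ((η : ℂ) ^ P.d) * ∑ b, τ (Y b * δ b))
    (hB : ∀ X X' : BondIdx D → 𝔸, B X X' = ∑ t, τ (X t * X' t))
    {HV KV : (BondIdx D → 𝔸) →ₗ[ℂ] (PBond P 0 → 𝔸)} {MV : (BondIdx D → 𝔸) →ₗ[ℂ] (BondIdx D → 𝔸)}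
    (hHV : ∀ (X : BondIdx D → 𝔸) (b : PBond P 0),
      HV X b = ∑ t, ((WithLp.ofLp (hOp (GE D hc hw) (QsE D) (EE D hc hw) (WithLp.toLp 2 (Pi.single t 1))) b : ℝ) : ℂ) • X t)
    (hMV : ∀ (X : BondIdx D → 𝔸) (t : BondIdx D),
      MV X t = ∑ s, ((WithLp.ofLp ((EE D hc hw - aE D w) (WithLp.toLp 2 (Pi.single s 1))) t : ℝ) : ℂ) • X s)
    (hKV : ∀ (X : BondIdx D → 𝔸) (b : PBond P 0),
      KV X b = ∑ s, ((WithLp.ofLp (dcsE c (dcE c (hOp (GE D hc hw) (QsE D) (EE D hc hw) (WithLp.toLp 2 (Pi.single s 1))))) b : ℝ) : ℂ) • X s)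
    (X X' : BondIdx D → 𝔸) :
    BE (HV X) (KV X') = B X (((η : ℂ) ^ P.d) • MV X') := by
  rw [hBE, hB]
  have lhs : ∑ b, τ (HV X b * KV X' b) =
      ∑ t, ∑ s, (∑ b, ((WithLp.ofLp (hOp (GE D hc hw) (QsE D) (EE D hc hw) (WithLp.toLp 2 (Pi.single t 1))) b : ℝ) : ℂ) *
        ((WithLp.ofLp (dcsE c (dcE c (hOp (GE D hc hw) (QsE D) (EE D hc hw) (WithLp.toLp 2 (Pi.single s 1))))) b : ℝ) : ℂ)) * τ (X t * X' s) := by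
    have step : ∀ b, τ (HV X b * KV X' b) =
        ∑ t, ∑ s, (((WithLp.ofLp (hOp (GE D hc hw) (QsE D) (EE D hc hw) (WithLp.toLp 2 (Pi.single t 1))) b : ℝ) : ℂ) *
          ((WithLp.ofLp (dcsE c (dcE c (hOp (GE D hc hw) (QsE D) (EE D hc hw) (WithLp.toLp 2 (Pi.single s 1))))) b : ℝ) : ℂ)) * τ (X t * X' s) := by
      intro b
      rw [hHV, hKV, Finset.sum_mul, map_sum]
      refine Finset.sum_congr rfl fun t _ => ?_
      rw [Finset.mul_sum, map_sum]
      refine Finset.sum_congr rfl fun s _ => ?_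
      rw [smul_mul_smul_comm, map_smul, smul_eq_mul]
    simp_rw [step]
    rw [Finset.sum_comm]
    refine Finset.sum_congr rfl fun t _ => ?_
    rw [Finset.sum_comm]
    refine Finset.sum_congr rfl fun s _ => ?_
    rw [Finset.sum_mul]
  have rhs : ∑ t, τ (X t * (((η : ℂ) ^ P.d) • MV X') t) =
      ((η : ℂ) ^ P.d) * ∑ t, ∑ s, ((WithLp.ofLp ((EE D hc hw - aE D w) (WithLp.toLp 2 (Pi.single s 1))) t : ℝ) : ℂ) * τ (X t * X' s) := by
    rw [Finset.mul_sum]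
    refine Finset.sum_congr rfl fun t _ => ?_
    rw [Pi.smul_apply, hMV, Finset.smul_sum, Finset.mul_sum, map_sum, Finset.mul_sum]
    refine Finset.sum_congr rfl fun s _ => ?_
    rw [smul_smul, mul_smul_comm, map_smul, smul_eq_mul]
    ring
  rw [lhs, rhs]
  congr 1
  refine Finset.sum_congr rfl fun t _ => Finset.sum_congr rfl fun s _ => ?_
  rw [mult_kernel_eq_sum D hc hw s t]
  push_cast
  rfl

end Pairings

end Summit.QuantumFields.YangMills.Theorems.K0Stub1MultiplierNormalisation

end
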